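import Literature.Analysis.UnboundedOperators.HeatSemigroup
import Literature.Analysis.UnboundedOperators.HeatKernelSymbol
import HarnessLib

/-!
# The heat equation `d/dt e^{tΔ} u = Δ e^{tΔ} u` in `𝓢'` (discharge)

Sibling proof file of `HeatSemigroup.lean` (D-0014: named facts `def X : Prop` are discharged as
`theorem X_holds : X`). It discharges

* `TemperedDistribution.hasDerivAt_heatSemigroup_holds : hasDerivAt_heatSemigroup E F` — for
  `0 < t`, every tempered distribution `u ∈ 𝓢'(E, F)` and every test function `φ ∈ 𝓢(E, ℂ)`,
  `s ↦ ⟨e^{sΔ} u, φ⟩` has derivative `⟨Δ (e^{tΔ} u), φ⟩` at `s = t`, where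
  `e^{tΔ} = TemperedDistribution.heatSemigroup t` is the Fourier multiplier with symbol
  `Literature.heatSymbol t ξ = exp (-(2π)² t ‖ξ‖²)`.

## Source and what it prints

Stein–Weiss, *Introduction to Fourier Analysis on Euclidean Spaces* (1971), Ch. I §1: the
Gauss–Weierstrass kernel `W(·, α)` is the function whose Fourier transform is the multiplier
`e^{-4π²α|t|²}` (pp. 9–11, §1.2 "Gauss summability"; p. 14, the display before Cor. 1.21:
`s(x, α) = ∫ f̂(t) e^{2πi x·t} e^{-4π²α|t|²} dt`), the Gauss–Weierstrass integrals form a semigroup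
(p. 18) and "the Gauss–Weierstrass method is intimately connected with the solution of the heat
equation" (p. 15, footnote 9). Theorem 1.18 there (p. 13) is the approximate-identity theorem
`‖f ⋆ φ_ε - f‖_p → 0`. The statement discharged here is the standard distributional form of the
heat equation for this multiplier semigroup: on the Fourier side `e^{tΔ}` multiplies by
`e^{-4π²t|ξ|²}`, whose `t`-derivative is `-4π²|ξ|² e^{-4π²t|ξ|²}`, the symbol of `Δ e^{tΔ}`
(Evans, *PDE*, §2.3.1, Thm. 1 (ii) is the same equation for the caloric extension of a function).

## Proof architecture (as formalised)

Write `a = (2π)²`, `g_s(ξ) = e^{-a s ‖ξ‖²}`, `ψ = 𝓕⁻¹ φ`. By definition of the Fourier multiplier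
on `𝓢'`, `⟨e^{sΔ} u, φ⟩ = u (𝓕 (g_s • ψ))` and, by
`TemperedDistribution.laplacian_eq_fourierMultiplierCLM`,
`⟨Δ e^{tΔ} u, φ⟩ = -a • u (𝓕 ((g_t ‖·‖²) • ψ))`. Hence
`⟨e^{(t+h)Δ} u, φ⟩ - ⟨e^{tΔ} u, φ⟩ - h ⟨Δ e^{tΔ} u, φ⟩ = u (𝓕 (R_h • ψ))` with the remainder
multiplier `R_h = ρ_h ∘ ‖·‖²`, `ρ_h(r) = e^{c₁r} - e^{c₀r} - (c₁ - c₀) r e^{c₀r}`, `c₀ = -at`,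
`c₁ = -a(t+h)`.

1. (`u ∘ 𝓕` has finite order.) `u ∘ 𝓕 : 𝓢(E, ℂ) → F` is continuous and linear, so by
   `Seminorm.bound_of_continuous` it is bounded by `C` times a finite supremum of Schwartz
   seminorms `p_{k,n}`.
2. (One variable.) `∂ʲ_r ρ_h(r) = Φ(c₁) - Φ(c₀) - (c₁ - c₀) Φ'(c₀)` with `Φ(c) = cʲ e^{cr}`
   (`iteratedDeriv_exp_const_mul` and `∂ʲ_r (r e^{cr}) = (j c^{j-1} + cʲ r) e^{cr}`); two
   applications of the mean value inequality give `|∂ʲ_r ρ_h(r)| ≤ (c₁ - c₀)² K_j (1 + r)²` for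
   `r ≥ 0` and `|c₁ - c₀| ≤ |c₀|/2` (all `c` between `c₀` and `c₁` are then `≤ 0`).
3. (Several variables.) `norm_iteratedFDeriv_comp_le` with inner function `‖·‖²` (temperate
   growth, `Function.hasTemperateGrowth_norm_sq`) gives
   `‖Dʲ R_h(x)‖ ≤ h² K (1 + ‖x‖)^l` for `j ≤ n`, `|h| ≤ t/2`.
4. (Leibniz.) As in Mathlib's `SchwartzMap.bilinLeftCLM`, `norm_iteratedFDeriv_smul_le` and
   `SchwartzMap.one_add_le_sup_seminorm_apply` give `p_{k,n}(R_h • ψ) ≤ h² K'`.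
5. Therefore the remainder is `O(h²) = o(h)`, which is `HasDerivAt`
   (`hasDerivAt_iff_isLittleO_nhds_zero`).

## Sources

* E. M. Stein, G. Weiss, *Introduction to Fourier Analysis on Euclidean Spaces*, Princeton
  (1971), Ch. I §1, pp. 9–15, 18 (Gauss–Weierstrass kernel and multiplier, footnote 9).
* L. C. Evans, *Partial Differential Equations*, 2nd ed. (2010), §2.3.1, Thm. 1.
-/

open MeasureTheory Filter Topology Set FourierTransform
open scoped Real SchwartzMap Laplacian ContDiff

noncomputable section

namespace Literature.Analysis.UnboundedOperators

namespace HeatSemigroupDeriv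

/-! ### One-variable estimates -/

/-- `∂ʲ_r (r e^{cr}) = (j c^{j-1} + cʲ r) e^{cr}`. [folklore] -/
theorem iteratedDeriv_id_mul_exp (c : ℝ) (j : ℕ) :
    iteratedDeriv j (fun r : ℝ => r * Real.exp (c * r)) =
      fun r => (j * c ^ (j - 1) + c ^ j * r) * Real.exp (c * r) := by
  induction j with
  | zero => funext r; simp
  | succ j ih =>
    rw [iteratedDeriv_succ, ih]
    funext r
    have h1 : HasDerivAt (fun r : ℝ => (j * c ^ (j - 1) + c ^ j * r)) (c ^ j) r := by
      simpa using ((hasDerivAt_id r).const_mul (c ^ j)).const_add ((j : ℝ) * c ^ (j - 1))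
    have h2 : HasDerivAt (fun r : ℝ => Real.exp (c * r)) (Real.exp (c * r) * c) r := by
      simpa using ((hasDerivAt_id r).const_mul c).exp
    rw [(h1.fun_mul h2).deriv]
    have key : (j : ℝ) * c ^ (j - 1) * c = j * c ^ j := by
      rcases Nat.eq_zero_or_pos j with rfl | hj
      · simp
      · rw [mul_assoc, pow_sub_one_mul (Nat.pos_iff_ne_zero.mp hj)]
    simp only [Nat.cast_succ, Nat.add_sub_cancel]
    linear_combination Real.exp (c * r) * key

/-- `d/dc (cʲ e^{cr}) = (j c^{j-1} + cʲ r) e^{cr}`. [folklore] -/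
theorem hasDerivAt_pow_mul_exp (j : ℕ) (r c : ℝ) :
    HasDerivAt (fun c : ℝ => c ^ j * Real.exp (c * r))
      ((j * c ^ (j - 1) + c ^ j * r) * Real.exp (c * r)) c := by
  have h1 : HasDerivAt (fun c : ℝ => c ^ j) (j * c ^ (j - 1)) c := hasDerivAt_pow j c
  have h2 : HasDerivAt (fun c : ℝ => Real.exp (c * r)) (Real.exp (c * r) * r) c := by
    simpa using ((hasDerivAt_id c).mul_const r).exp
  refine (h1.fun_mul h2).congr_deriv ?_
  ring

/-- The second `c`-derivative of `cʲ e^{cr}` (in the raw form produced by the product rule).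
[folklore] -/
theorem hasDerivAt_pow_mul_exp_deriv (j : ℕ) (r c : ℝ) :
    HasDerivAt (fun c : ℝ => (j * c ^ (j - 1) + c ^ j * r) * Real.exp (c * r))
      ((j * ((j - 1 : ℕ) * c ^ (j - 1 - 1)) + j * c ^ (j - 1) * r) * Real.exp (c * r) +
        (j * c ^ (j - 1) + c ^ j * r) * (Real.exp (c * r) * r)) c := by
  have h1 : HasDerivAt (fun c : ℝ => (j * c ^ (j - 1) + c ^ j * r))
      (j * ((j - 1 : ℕ) * c ^ (j - 1 - 1)) + j * c ^ (j - 1) * r) c :=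
    ((hasDerivAt_pow (j - 1) c).const_mul (j : ℝ)).fun_add ((hasDerivAt_pow j c).mul_const r)
  have h2 : HasDerivAt (fun c : ℝ => Real.exp (c * r)) (Real.exp (c * r) * r) c := by
    simpa using ((hasDerivAt_id c).mul_const r).exp
  exact h1.fun_mul h2

/-- Bound on the second `c`-derivative of `cʲ e^{cr}` for `c ∈ [-M, 0]`, `r ≥ 0`, `M ≥ 1`:
it is at most `Mʲ (j+1)² (1+r)²`. [folklore] -/
theorem abs_deriv2_pow_mul_exp_le (j : ℕ) {M r c : ℝ} (hM : 1 ≤ M) (hc : c ≤ 0) (hcM : |c| ≤ M)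
    (hr : 0 ≤ r) :
    |(j * ((j - 1 : ℕ) * c ^ (j - 1 - 1)) + j * c ^ (j - 1) * r) * Real.exp (c * r) +
        (j * c ^ (j - 1) + c ^ j * r) * (Real.exp (c * r) * r)|
      ≤ M ^ j * (j + 1) ^ 2 * (1 + r) ^ 2 := by
  have he : Real.exp (c * r) ≤ 1 := Real.exp_le_one_iff.mpr (mul_nonpos_of_nonpos_of_nonneg hc hr)
  have he0 : 0 < Real.exp (c * r) := Real.exp_pos _
  have hM0 : 0 ≤ M := zero_le_one.trans hM
  have hpow : ∀ m, m ≤ j → |c| ^ m ≤ M ^ j := fun m hm =>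
    (pow_le_pow_left₀ (abs_nonneg c) hcM m).trans (pow_le_pow_right₀ hM hm)
  have hA : |(j : ℝ) * ((j - 1 : ℕ) * c ^ (j - 1 - 1))| ≤ j * (j * M ^ j) := by
    rw [abs_mul, abs_mul, abs_pow, Nat.abs_cast, Nat.abs_cast]
    have h1 : ((j - 1 : ℕ) : ℝ) ≤ j := by exact_mod_cast Nat.sub_le j 1
    have h2 : |c| ^ (j - 1 - 1) ≤ M ^ j := hpow _ ((Nat.sub_le _ _).trans (Nat.sub_le _ _))
    exact mul_le_mul_of_nonneg_left (mul_le_mul h1 h2 (by positivity) (by positivity))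
      (by positivity)
  have hB : |(j : ℝ) * c ^ (j - 1) * r| ≤ j * M ^ j * r := by
    rw [abs_mul, abs_mul, abs_pow, Nat.abs_cast, abs_of_nonneg hr]
    exact mul_le_mul_of_nonneg_right
      (mul_le_mul_of_nonneg_left (hpow _ (Nat.sub_le _ _)) (by positivity)) hr
  have hC : |c ^ j * r * r| ≤ M ^ j * r * r := by
    rw [abs_mul, abs_mul, abs_pow, abs_of_nonneg hr]
    exact mul_le_mul_of_nonneg_right (mul_le_mul_of_nonneg_right (hpow _ le_rfl) hr) hr
  have hsum : |(j * ((j - 1 : ℕ) * c ^ (j - 1 - 1)) + j * c ^ (j - 1) * r) +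
      (j * c ^ (j - 1) + c ^ j * r) * r| ≤ M ^ j * (j + r) ^ 2 := by
    have e1 : (j * ((j - 1 : ℕ) * c ^ (j - 1 - 1)) + j * c ^ (j - 1) * r) +
        (j * c ^ (j - 1) + c ^ j * r) * r =
        j * ((j - 1 : ℕ) * c ^ (j - 1 - 1)) + j * c ^ (j - 1) * r + j * c ^ (j - 1) * r
          + c ^ j * r * r := by ring
    rw [e1]
    have t1 := abs_add_le ((j : ℝ) * ((j - 1 : ℕ) * c ^ (j - 1 - 1)) + j * c ^ (j - 1) * r +
      j * c ^ (j - 1) * r) (c ^ j * r * r)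
    have t2 := abs_add_le ((j : ℝ) * ((j - 1 : ℕ) * c ^ (j - 1 - 1)) + j * c ^ (j - 1) * r)
      (j * c ^ (j - 1) * r)
    have t3 := abs_add_le ((j : ℝ) * ((j - 1 : ℕ) * c ^ (j - 1 - 1))) (j * c ^ (j - 1) * r)
    have e2 : M ^ j * (j + r) ^ 2 =
        j * (j * M ^ j) + j * M ^ j * r + j * M ^ j * r + M ^ j * r * r := by ring
    linarith
  have hfac : (j * ((j - 1 : ℕ) * c ^ (j - 1 - 1)) + j * c ^ (j - 1) * r) * Real.exp (c * r) +
        (j * c ^ (j - 1) + c ^ j * r) * (Real.exp (c * r) * r) =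
      ((j * ((j - 1 : ℕ) * c ^ (j - 1 - 1)) + j * c ^ (j - 1) * r) +
        (j * c ^ (j - 1) + c ^ j * r) * r) * Real.exp (c * r) := by ring
  rw [hfac, abs_mul, abs_of_pos he0]
  have hjr : (j + r) ^ 2 ≤ (j + 1) ^ 2 * (1 + r) ^ 2 := by
    rw [← mul_pow]
    apply pow_le_pow_left₀ (by positivity)
    nlinarith [mul_nonneg (Nat.cast_nonneg j : (0 : ℝ) ≤ j) hr]
  calc _ ≤ M ^ j * (j + r) ^ 2 * 1 := mul_le_mul hsum he he0.le (by positivity)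
    _ ≤ M ^ j * (j + 1) ^ 2 * (1 + r) ^ 2 := by
        rw [mul_one, mul_assoc]
        exact mul_le_mul_of_nonneg_left hjr (by positivity)

/-- Second-order Taylor estimate on a segment, from two applications of the mean value
inequality: if `|Φ''| ≤ B` between `c₀` and `c₁` then
`|Φ(c₁) - Φ(c₀) - (c₁ - c₀) Φ'(c₀)| ≤ B (c₁ - c₀)²`. [folklore] -/
theorem abs_sub_sub_mul_le_of_deriv2 {Φ Φ' Φ'' : ℝ → ℝ} {c₀ c₁ B : ℝ}
    (hΦ : ∀ c, HasDerivAt Φ (Φ' c) c) (hΦ' : ∀ c, HasDerivAt Φ' (Φ'' c) c)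
    (hB : ∀ c ∈ uIcc c₀ c₁, |Φ'' c| ≤ B) :
    |Φ c₁ - Φ c₀ - (c₁ - c₀) * Φ' c₀| ≤ B * (c₁ - c₀) ^ 2 := by
  have h1 : ∀ c ∈ uIcc c₀ c₁, |Φ' c - Φ' c₀| ≤ B * |c₁ - c₀| := by
    intro c hc
    have hmv := (convex_uIcc c₀ c₁).norm_image_sub_le_of_norm_hasDerivWithin_le
      (f := Φ') (f' := Φ'') (fun x _ => (hΦ' x).hasDerivWithinAt)
      (fun x hx => by simpa only [Real.norm_eq_abs] using hB x hx) left_mem_uIcc hc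
    rw [Real.norm_eq_abs, Real.norm_eq_abs] at hmv
    calc |Φ' c - Φ' c₀| ≤ B * |c - c₀| := hmv
      _ ≤ B * |c₁ - c₀| :=
          mul_le_mul_of_nonneg_left (abs_sub_left_of_mem_uIcc hc)
            ((abs_nonneg _).trans (hB c₀ left_mem_uIcc))
  have h2 := (convex_uIcc c₀ c₁).norm_image_sub_le_of_norm_hasDerivWithin_le
      (f := fun c => Φ c - c * Φ' c₀) (f' := fun c => Φ' c - Φ' c₀)
      (fun x _ => by
        simpa only [one_mul] using
          ((hΦ x).fun_sub ((hasDerivAt_id' x).mul_const (Φ' c₀))).hasDerivWithinAt)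
      (fun x hx => by simpa only [Real.norm_eq_abs] using h1 x hx) left_mem_uIcc right_mem_uIcc
  rw [Real.norm_eq_abs, Real.norm_eq_abs] at h2
  calc |Φ c₁ - Φ c₀ - (c₁ - c₀) * Φ' c₀|
      = |Φ c₁ - c₁ * Φ' c₀ - (Φ c₀ - c₀ * Φ' c₀)| := by ring_nf
    _ ≤ B * |c₁ - c₀| * |c₁ - c₀| := h2
    _ = B * (c₁ - c₀) ^ 2 := by rw [mul_assoc, abs_mul_abs_self, sq]

/-- The remainder `ρ(r) = e^{c₁ r} - e^{c₀ r} - (c₁ - c₀) r e^{c₀ r}` of the first-order Taylor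
expansion of `c ↦ e^{cr}` at `c₀` is smooth in `r`. [folklore] -/
theorem contDiff_rho (c₀ c₁ : ℝ) {m : WithTop ℕ∞} :
    ContDiff ℝ m (fun r : ℝ =>
      Real.exp (c₁ * r) - Real.exp (c₀ * r) - (c₁ - c₀) * (r * Real.exp (c₀ * r))) := by
  fun_prop

/-- For `ρ(r) = e^{c₁ r} - e^{c₀ r} - (c₁ - c₀) r e^{c₀ r}`:
`∂ʲ_r ρ(r) = c₁ʲ e^{c₁r} - c₀ʲ e^{c₀ r} - (c₁ - c₀)(j c₀^{j-1} + c₀ʲ r) e^{c₀ r}`. [folklore] -/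
theorem iteratedDeriv_rho (c₀ c₁ : ℝ) (j : ℕ) (r : ℝ) :
    iteratedDeriv j (fun r : ℝ =>
      Real.exp (c₁ * r) - Real.exp (c₀ * r) - (c₁ - c₀) * (r * Real.exp (c₀ * r))) r =
      c₁ ^ j * Real.exp (c₁ * r) - c₀ ^ j * Real.exp (c₀ * r) -
        (c₁ - c₀) * ((j * c₀ ^ (j - 1) + c₀ ^ j * r) * Real.exp (c₀ * r)) := by
  have hd1 : ContDiff ℝ j (fun r : ℝ => Real.exp (c₁ * r)) := by fun_prop
  have hd0 : ContDiff ℝ j (fun r : ℝ => Real.exp (c₀ * r)) := by fun_prop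
  have hd3 : ContDiff ℝ j (fun r : ℝ => r * Real.exp (c₀ * r)) := by fun_prop
  have hd2 : ContDiff ℝ j (fun r : ℝ => (c₁ - c₀) * (r * Real.exp (c₀ * r))) := by fun_prop
  have e : (fun r : ℝ =>
      Real.exp (c₁ * r) - Real.exp (c₀ * r) - (c₁ - c₀) * (r * Real.exp (c₀ * r))) =
      fun r => (Real.exp (c₁ * r) - Real.exp (c₀ * r)) - (c₁ - c₀) * (r * Real.exp (c₀ * r)) :=
    rfl
  rw [e, iteratedDeriv_fun_sub (hd1.sub hd0).contDiffAt hd2.contDiffAt,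
    iteratedDeriv_fun_sub hd1.contDiffAt hd0.contDiffAt,
    iteratedDeriv_const_mul _ hd3.contDiffAt]
  simp only [iteratedDeriv_exp_const_mul, iteratedDeriv_id_mul_exp]

/-- Uniform bound for the `r`-derivatives of the remainder `ρ`: for `c₀ < 0` and each `j` there is
`K ≥ 0` with `|∂ʲ_r ρ(r)| ≤ (c₁ - c₀)² K (1 + r)²` for all `r ≥ 0` and all `c₁` with
`|c₁ - c₀| ≤ |c₀|/2`. [folklore] -/
theorem abs_iteratedDeriv_rho_le {c₀ : ℝ} (hc₀ : c₀ < 0) (j : ℕ) :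
    ∃ K : ℝ, 0 ≤ K ∧ ∀ c₁ : ℝ, |c₁ - c₀| ≤ |c₀| / 2 → ∀ r : ℝ, 0 ≤ r →
      |iteratedDeriv j (fun r : ℝ =>
          Real.exp (c₁ * r) - Real.exp (c₀ * r) - (c₁ - c₀) * (r * Real.exp (c₀ * r))) r|
        ≤ (c₁ - c₀) ^ 2 * (K * (1 + r) ^ 2) := by
  set M : ℝ := max 1 (2 * |c₀|) with hM_def
  refine ⟨M ^ j * (j + 1) ^ 2, by positivity, fun c₁ hc₁ r hr => ?_⟩
  rw [iteratedDeriv_rho]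
  have key := abs_sub_sub_mul_le_of_deriv2 (Φ := fun c => c ^ j * Real.exp (c * r))
    (c₀ := c₀) (c₁ := c₁) (B := M ^ j * (j + 1) ^ 2 * (1 + r) ^ 2)
    (fun c => hasDerivAt_pow_mul_exp j r c) (fun c => hasDerivAt_pow_mul_exp_deriv j r c)
    (fun c hc => ?_)
  · calc _ ≤ M ^ j * (j + 1) ^ 2 * (1 + r) ^ 2 * (c₁ - c₀) ^ 2 := key
      _ = (c₁ - c₀) ^ 2 * (M ^ j * (↑j + 1) ^ 2 * (1 + r) ^ 2) := by ring
  · have hcc₀ : |c - c₀| ≤ |c₀| / 2 := (abs_sub_left_of_mem_uIcc hc).trans hc₁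
    have hc₀' : |c₀| = -c₀ := abs_of_neg hc₀
    have hc0 : c ≤ 0 := by
      have := (abs_sub_le_iff.1 hcc₀).1
      linarith
    have hcM : |c| ≤ M := by
      have : |c| ≤ |c - c₀| + |c₀| := by
        simpa using abs_add_le (c - c₀) c₀
      calc |c| ≤ |c₀| / 2 + |c₀| := by linarith
        _ ≤ 2 * |c₀| := by linarith [abs_nonneg c₀]
        _ ≤ M := le_max_right _ _
    exact abs_deriv2_pow_mul_exp_le j (le_max_left _ _) hc0 hcM hr

/-! ### The remainder multiplier on `E` -/

section Remainder

variable {E : Type*} [NormedAddCommGroup E]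

/-- The remainder multiplier `R_h = g_{t+h} - g_t - h ∂_t g_t` of the heat symbol
`g_t(ξ) = exp (-(2π)² t ‖ξ‖²)` (`∂_t g_t = -(2π)² ‖ξ‖² g_t`) factors as `R_h = ρ ∘ ‖·‖²` with
`ρ(r) = e^{c₁ r} - e^{c₀ r} - (c₁ - c₀) r e^{c₀ r}`, `c₀ = -(2π)² t`, `c₁ = -(2π)² (t + h)`.
[folklore] -/
theorem heatRemainder_eq_comp (t h : ℝ) :
    (fun x : E => Literature.Analysis.UnboundedOperators.heatSymbol (t + h) x - Literature.Analysis.UnboundedOperators.heatSymbol t x +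
        h * ((2 * π) ^ 2 * ‖x‖ ^ 2 * Literature.Analysis.UnboundedOperators.heatSymbol t x)) =
      (fun r : ℝ => Real.exp (-(2 * π) ^ 2 * (t + h) * r) - Real.exp (-(2 * π) ^ 2 * t * r) -
          (-(2 * π) ^ 2 * (t + h) - -(2 * π) ^ 2 * t) * (r * Real.exp (-(2 * π) ^ 2 * t * r))) ∘
        fun x : E => ‖x‖ ^ 2 := by
  funext x
  simp only [Literature.Analysis.UnboundedOperators.heatSymbol, Function.comp_apply]
  ring_nf

variable [InnerProductSpace ℝ E]

/-- On a real inner product space the remainder multiplier `R_h` is smooth. [folklore] -/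
theorem contDiff_heatRemainder (t h : ℝ) {m : WithTop ℕ∞} :
    ContDiff ℝ m (fun x : E => Literature.Analysis.UnboundedOperators.heatSymbol (t + h) x - Literature.Analysis.UnboundedOperators.heatSymbol t x +
      h * ((2 * π) ^ 2 * ‖x‖ ^ 2 * Literature.Analysis.UnboundedOperators.heatSymbol t x)) := by
  rw [heatRemainder_eq_comp]
  exact (contDiff_rho _ _).comp (contDiff_norm_sq ℝ)

/-- Uniform temperate bounds for the remainder multiplier `R_h = g_{t+h} - g_t - h ∂_t g_t` of
the heat symbol: for `0 < t` and each `n` there are `l`, `K` with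
`‖Dʲ R_h(x)‖ ≤ h² K (1 + ‖x‖)^l` for all `j ≤ n`, `|h| ≤ t/2`, `x`. [folklore] -/
theorem norm_iteratedFDeriv_heatRemainder_le {t : ℝ} (ht : 0 < t) (n : ℕ) :
    ∃ (l : ℕ) (K : ℝ), 0 ≤ K ∧ ∀ h : ℝ, |h| ≤ t / 2 → ∀ j, j ≤ n → ∀ x : E,
      ‖iteratedFDeriv ℝ j (fun x : E => Literature.Analysis.UnboundedOperators.heatSymbol (t + h) x - Literature.Analysis.UnboundedOperators.heatSymbol t x +
          h * ((2 * π) ^ 2 * ‖x‖ ^ 2 * Literature.Analysis.UnboundedOperators.heatSymbol t x)) x‖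
        ≤ h ^ 2 * (K * (1 + ‖x‖) ^ l) := by
  obtain ⟨lq, Cq, hCq, hq⟩ :=
    (Function.hasTemperateGrowth_norm_sq E).norm_iteratedFDeriv_le_uniform n
  have ha : (0 : ℝ) < (2 * π) ^ 2 := by positivity
  have hc₀ : -(2 * π) ^ 2 * t < 0 := by
    have : 0 < (2 * π) ^ 2 * t := by positivity
    linarith
  choose K hK0 hK using fun j => abs_iteratedDeriv_rho_le hc₀ j
  set K₁ : ℝ := ∑ j ∈ Finset.range (n + 1), K j with hK₁_def
  have hK₁ : 0 ≤ K₁ := Finset.sum_nonneg fun j _ => hK0 j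
  have hKle : ∀ j, j ≤ n → K j ≤ K₁ := fun j hj =>
    Finset.single_le_sum (fun i _ => hK0 i) (Finset.mem_range_succ_iff.mpr hj)
  refine ⟨4 + lq * n, n.factorial * (((2 * π) ^ 2) ^ 2 * K₁) * (1 + Cq) ^ n, by positivity,
    fun h hh j hj x => ?_⟩
  rw [heatRemainder_eq_comp]
  -- the outer one-variable function
  set ρ : ℝ → ℝ := fun r : ℝ => Real.exp (-(2 * π) ^ 2 * (t + h) * r) -
      Real.exp (-(2 * π) ^ 2 * t * r) -
      (-(2 * π) ^ 2 * (t + h) - -(2 * π) ^ 2 * t) * (r * Real.exp (-(2 * π) ^ 2 * t * r))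
    with hρ_def
  have hρ : ContDiff ℝ ((⊤ : ℕ∞) : WithTop ℕ∞) ρ := contDiff_rho _ _
  have hc₁c₀ : -(2 * π) ^ 2 * (t + h) - -(2 * π) ^ 2 * t = -(2 * π) ^ 2 * h := by ring
  have hc₁ : |-(2 * π) ^ 2 * (t + h) - -(2 * π) ^ 2 * t| ≤ |-(2 * π) ^ 2 * t| / 2 := by
    rw [hc₁c₀, abs_of_neg hc₀, neg_mul, abs_neg, abs_mul, abs_of_pos ha]
    have : (2 * π) ^ 2 * |h| ≤ (2 * π) ^ 2 * (t / 2) := by gcongr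
    linarith
  -- bounds for the outer function at `r = ‖x‖²`
  set Cout : ℝ := ((2 * π) ^ 2 * h) ^ 2 * (K₁ * (1 + ‖x‖ ^ 2) ^ 2) with hCout_def
  have hC : ∀ i, i ≤ j → ‖iteratedFDeriv ℝ i ρ (‖x‖ ^ 2)‖ ≤ Cout := by
    intro i hi
    rw [norm_iteratedFDeriv_eq_norm_iteratedDeriv, Real.norm_eq_abs]
    calc _ ≤ (-(2 * π) ^ 2 * (t + h) - -(2 * π) ^ 2 * t) ^ 2 * (K i * (1 + ‖x‖ ^ 2) ^ 2) :=
          hK i _ hc₁ _ (by positivity)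
      _ ≤ (-(2 * π) ^ 2 * (t + h) - -(2 * π) ^ 2 * t) ^ 2 * (K₁ * (1 + ‖x‖ ^ 2) ^ 2) := by
          gcongr
          exact hKle i (hi.trans hj)
      _ = Cout := by rw [hCout_def, hc₁c₀]; ring
  -- bounds for the inner function
  set D : ℝ := 1 + Cq * (1 + ‖x‖) ^ lq with hD_def
  have hD1 : 1 ≤ D := le_add_of_nonneg_right (by positivity)
  have hD : ∀ i, 1 ≤ i → i ≤ j → ‖iteratedFDeriv ℝ i (fun x : E => ‖x‖ ^ 2) x‖ ≤ D ^ i := by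
    intro i hi hij
    calc _ ≤ Cq * (1 + ‖x‖) ^ lq := hq i (hij.trans hj) x
      _ ≤ D := le_add_of_nonneg_left zero_le_one
      _ ≤ D ^ i := le_self_pow₀ hD1 (Nat.one_le_iff_ne_zero.mp hi)
  have hcomp := norm_iteratedFDeriv_comp_le (𝕜 := ℝ) (n := j) hρ (contDiff_norm_sq ℝ (E := E))
    (mod_cast le_top) x hC hD
  have hx1 : 1 ≤ 1 + ‖x‖ := le_add_of_nonneg_right (norm_nonneg x)
  have hDle : D ≤ (1 + Cq) * (1 + ‖x‖) ^ lq := by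
    have : 1 ≤ (1 + ‖x‖) ^ lq := one_le_pow₀ hx1
    rw [hD_def]
    nlinarith
  have hsq : (1 + ‖x‖ ^ 2) ^ 2 ≤ (1 + ‖x‖) ^ 4 := by
    have : 1 + ‖x‖ ^ 2 ≤ (1 + ‖x‖) ^ 2 := by nlinarith [norm_nonneg x]
    calc (1 + ‖x‖ ^ 2) ^ 2 ≤ ((1 + ‖x‖) ^ 2) ^ 2 := by gcongr
      _ = (1 + ‖x‖) ^ 4 := by ring
  have hCout0 : 0 ≤ Cout := by positivity
  have hfact : (j.factorial : ℝ) ≤ n.factorial := by exact_mod_cast Nat.factorial_le hj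
  have hDpow : D ^ j ≤ ((1 + Cq) * (1 + ‖x‖) ^ lq) ^ n :=
    (pow_le_pow_right₀ hD1 hj).trans (pow_le_pow_left₀ (zero_le_one.trans hD1) hDle n)
  calc ‖iteratedFDeriv ℝ j (ρ ∘ fun x : E => ‖x‖ ^ 2) x‖
      ≤ j.factorial * Cout * D ^ j := hcomp
    _ ≤ n.factorial * Cout * ((1 + Cq) * (1 + ‖x‖) ^ lq) ^ n :=
        mul_le_mul (mul_le_mul_of_nonneg_right hfact hCout0) hDpow (by positivity)
          (by positivity)
    _ = h ^ 2 * ((n.factorial * (((2 * π) ^ 2) ^ 2 * K₁) * (1 + Cq) ^ n) *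
          ((1 + ‖x‖ ^ 2) ^ 2 * (1 + ‖x‖) ^ (lq * n))) := by
        rw [hCout_def, mul_pow (1 + Cq) ((1 + ‖x‖) ^ lq) n, ← pow_mul]
        ring
    _ ≤ h ^ 2 * ((n.factorial * (((2 * π) ^ 2) ^ 2 * K₁) * (1 + Cq) ^ n) *
          (1 + ‖x‖) ^ (4 + lq * n)) := by
        rw [pow_add]
        gcongr

end Remainder

/-! ### Leibniz: Schwartz decay of `R • ψ` from temperate bounds on `R` -/

section Leibniz

variable {E : Type*} [NormedAddCommGroup E] [NormedSpace ℝ E]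
variable {V : Type*} [NormedAddCommGroup V] [NormedSpace ℝ V]

/-- If `‖Dʲ R(x)‖ ≤ ε (1 + ‖x‖)^l` for `j ≤ n`, then
`‖x‖^k ‖Dⁿ (R • ψ)(x)‖ ≤ ε K` with `K` depending only on `ψ, k, n, l` (the estimate behind
Mathlib's `SchwartzMap.bilinLeftCLM`). [folklore] -/
theorem pow_mul_norm_iteratedFDeriv_smul_le (ψ : 𝓢(E, V)) (k n l : ℕ) :
    ∃ K : ℝ, 0 ≤ K ∧ ∀ (R : E → ℝ) (ε : ℝ), 0 ≤ ε → ContDiff ℝ ∞ R →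
      (∀ j, j ≤ n → ∀ x, ‖iteratedFDeriv ℝ j R x‖ ≤ ε * (1 + ‖x‖) ^ l) →
      ∀ x, ‖x‖ ^ k * ‖iteratedFDeriv ℝ n (fun y => R y • ψ y) x‖ ≤ ε * K := by
  set S : ℝ := (Finset.Iic (l + k, n)).sup (fun m => SchwartzMap.seminorm ℝ m.1 m.2) ψ
    with hS_def
  have hS : 0 ≤ S := apply_nonneg _ _
  refine ⟨(∑ i ∈ Finset.range (n + 1), (n.choose i : ℝ)) * (2 ^ (l + k) * S), by positivity, ?_⟩
  intro R ε hε hR hbound x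
  have hleib := norm_iteratedFDeriv_smul_le (𝕜 := ℝ) hR (ψ.smooth ⊤) x (n := n)
    (mod_cast le_top)
  have hterm : ∀ i ∈ Finset.range (n + 1),
      (n.choose i : ℝ) * ‖iteratedFDeriv ℝ i R x‖ * ‖iteratedFDeriv ℝ (n - i) ψ x‖ * ‖x‖ ^ k
        ≤ (n.choose i : ℝ) * (ε * (2 ^ (l + k) * S)) := by
    intro i hi
    have hi' : i ≤ n := Finset.mem_range_succ_iff.mp hi
    have h1 : ‖iteratedFDeriv ℝ i R x‖ ≤ ε * (1 + ‖x‖) ^ l := hbound i hi' x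
    have h2 : (1 + ‖x‖) ^ l * (‖x‖ ^ k * ‖iteratedFDeriv ℝ (n - i) ψ x‖) ≤ 2 ^ (l + k) * S := by
      calc (1 + ‖x‖) ^ l * (‖x‖ ^ k * ‖iteratedFDeriv ℝ (n - i) ψ x‖)
          ≤ (1 + ‖x‖) ^ l * ((1 + ‖x‖) ^ k * ‖iteratedFDeriv ℝ (n - i) ψ x‖) := by
            gcongr
            exact le_add_of_nonneg_left zero_le_one
        _ = (1 + ‖x‖) ^ (l + k) * ‖iteratedFDeriv ℝ (n - i) ψ x‖ := by rw [pow_add]; ring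
        _ ≤ 2 ^ (l + k, n).1 *
              (Finset.Iic (l + k, n)).sup (fun m => SchwartzMap.seminorm ℝ m.1 m.2) ψ :=
            SchwartzMap.one_add_le_sup_seminorm_apply (m := (l + k, n)) le_rfl (Nat.sub_le n i) ψ x
        _ = 2 ^ (l + k) * S := rfl
    calc (n.choose i : ℝ) * ‖iteratedFDeriv ℝ i R x‖ * ‖iteratedFDeriv ℝ (n - i) ψ x‖ * ‖x‖ ^ k
        = (n.choose i : ℝ) * (‖iteratedFDeriv ℝ i R x‖ *
            (‖x‖ ^ k * ‖iteratedFDeriv ℝ (n - i) ψ x‖)) := by ring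
      _ ≤ (n.choose i : ℝ) * ((ε * (1 + ‖x‖) ^ l) *
            (‖x‖ ^ k * ‖iteratedFDeriv ℝ (n - i) ψ x‖)) := by
          gcongr
      _ = (n.choose i : ℝ) * (ε * ((1 + ‖x‖) ^ l *
            (‖x‖ ^ k * ‖iteratedFDeriv ℝ (n - i) ψ x‖))) := by ring
      _ ≤ (n.choose i : ℝ) * (ε * (2 ^ (l + k) * S)) := by
          gcongr
  calc ‖x‖ ^ k * ‖iteratedFDeriv ℝ n (fun y => R y • ψ y) x‖
      ≤ ‖x‖ ^ k * ∑ i ∈ Finset.range (n + 1),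
          (n.choose i : ℝ) * ‖iteratedFDeriv ℝ i R x‖ * ‖iteratedFDeriv ℝ (n - i) ψ x‖ := by
        gcongr
    _ = ∑ i ∈ Finset.range (n + 1),
          (n.choose i : ℝ) * ‖iteratedFDeriv ℝ i R x‖ * ‖iteratedFDeriv ℝ (n - i) ψ x‖ *
            ‖x‖ ^ k := by
        rw [Finset.mul_sum]
        exact Finset.sum_congr rfl fun i _ => by ring
    _ ≤ ∑ i ∈ Finset.range (n + 1), (n.choose i : ℝ) * (ε * (2 ^ (l + k) * S)) :=
        Finset.sum_le_sum hterm
    _ = ε * ((∑ i ∈ Finset.range (n + 1), (n.choose i : ℝ)) * (2 ^ (l + k) * S)) := by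
        rw [Finset.sum_mul, Finset.mul_sum]
        exact Finset.sum_congr rfl fun i _ => by ring

end Leibniz

end HeatSemigroupDeriv

end Literature.Analysis.UnboundedOperators

/-! ### The heat equation in `𝓢'` -/

namespace TemperedDistribution

open Literature.Analysis.UnboundedOperators.HeatSemigroupDeriv

variable {E F : Type*} [NormedAddCommGroup E] [InnerProductSpace ℝ E] [FiniteDimensional ℝ E]
  [MeasurableSpace E] [BorelSpace E] [NormedAddCommGroup F] [NormedSpace ℂ F]

/-- **Discharge of `TemperedDistribution.hasDerivAt_heatSemigroup`** (the heat equation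
`d/dt e^{tΔ} u = Δ e^{tΔ} u` in `𝓢'(E, F)`, weak-* sense): for `0 < t`, `u ∈ 𝓢'(E, F)` and
`φ ∈ 𝓢(E, ℂ)`, `s ↦ ⟨e^{sΔ} u, φ⟩` has derivative `⟨Δ (e^{tΔ} u), φ⟩` at `t`.
Proof: `⟨e^{sΔ}u, φ⟩ = u (𝓕 (g_s • 𝓕⁻¹φ))` with `g_s = e^{-4π²s‖·‖²}` the Gauss–Weierstrass
multiplier; `u ∘ 𝓕` is bounded by finitely many Schwartz seminorms, and every Schwartz seminorm
of `(g_{t+h} - g_t - h ∂_t g_t) • 𝓕⁻¹φ` is `O(h²)` (one-variable Taylor estimate in the exponent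
coefficient, `norm_iteratedFDeriv_comp_le` through `‖·‖²`, Leibniz rule), so the remainder is
`o(h)`. Stein–Weiss (1971), Ch. I §1: the Gauss–Weierstrass kernel is the Fourier multiplier
`e^{-4π²α|t|²}` (pp. 9–11, 14), a semigroup (p. 18), "intimately connected with the solution of
the heat equation" (p. 15, footnote 9); the printed Thm. 1.18 (p. 13) is the approximate-identity
theorem. Evans, *PDE*, §2.3.1, Thm. 1 (ii) (heat equation for the caloric extension).
[cite: SteinWeiss1971, Ch. I §1, pp. 9–15] -/
theorem hasDerivAt_heatSemigroup_holds : hasDerivAt_heatSemigroup E F := by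
  intro t ht u φ
  have hE : Literature.Analysis.UnboundedOperators.heatSymbol_hasTemperateGrowth (E := E) :=
    @Literature.Analysis.UnboundedOperators.heatSymbol_hasTemperateGrowth_holds E _ _
  set ψ : 𝓢(E, ℂ) := 𝓕⁻ φ with hψ_def
  -- the complexified multipliers
  set g : ℝ → E → ℂ := fun s x => (Literature.Analysis.UnboundedOperators.heatSymbol s x : ℂ) with hg_def
  set q : E → ℂ := fun x => ((‖x‖ ^ 2 : ℝ) : ℂ) with hq_def
  have hg : ∀ {s : ℝ}, 0 ≤ s → (g s).HasTemperateGrowth := fun hs =>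
    Literature.Analysis.UnboundedOperators.heatSymbol_hasTemperateGrowth_complex hE hs
  have hq : q.HasTemperateGrowth := by simp only [hq_def]; fun_prop
  have hgq : (g t * q).HasTemperateGrowth := (hg ht.le).mul hq
  -- (1) the values of `s ↦ ⟨e^{sΔ} u, φ⟩`
  have hval : ∀ s, heatSemigroup s u φ = u (𝓕 (SchwartzMap.smulLeftCLM ℂ (g s) ψ)) :=
    fun s => rfl
  -- (2) the value of the derivative
  have hder : Δ (heatSemigroup t u) φ =
      -(2 * π) ^ 2 • u (𝓕 (SchwartzMap.smulLeftCLM ℂ (g t * q) ψ)) := by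
    rw [laplacian_eq_fourierMultiplierCLM, heatSemigroup_eq_fourierMultiplierCLM,
      fourierMultiplierCLM_fourierMultiplierCLM_apply (hg ht.le) hq, smul_apply]
    rfl
  -- (3) the remainder as `u (𝓕 (R_h • ψ))`
  set Dh : ℝ → 𝓢(E, ℂ) := fun h =>
    SchwartzMap.smulLeftCLM ℂ (g (t + h)) ψ - SchwartzMap.smulLeftCLM ℂ (g t) ψ +
      ((h * (2 * π) ^ 2 : ℝ) : ℂ) • SchwartzMap.smulLeftCLM ℂ (g t * q) ψ with hDh_def
  have hrem : ∀ h, heatSemigroup (t + h) u φ - heatSemigroup t u φ -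
      h • Δ (heatSemigroup t u) φ = u (𝓕 (Dh h)) := by
    intro h
    rw [hval, hval, hder]
    simp only [hDh_def, sub_eq_add_neg, FourierAdd.fourier_add, FourierTransform.fourier_neg,
      map_add, map_neg, FourierSMul.fourier_smul, map_smul]
    rw [Complex.coe_smul]
    module
  -- pointwise form of the remainder for `|h| ≤ t/2` (so that `t + h ≥ 0`)
  have hDh_apply : ∀ h, |h| ≤ t / 2 → ⇑(Dh h) = fun x =>
      (Literature.Analysis.UnboundedOperators.heatSymbol (t + h) x - Literature.Analysis.UnboundedOperators.heatSymbol t x +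
        h * ((2 * π) ^ 2 * ‖x‖ ^ 2 * Literature.Analysis.UnboundedOperators.heatSymbol t x)) • ψ x := by
    intro h hh
    have hth : 0 ≤ t + h := by
      have := (abs_le.1 hh).1
      linarith
    funext x
    simp only [hDh_def, sub_apply, add_apply, smul_apply,
      SchwartzMap.smulLeftCLM_apply_apply (hg hth), SchwartzMap.smulLeftCLM_apply_apply (hg ht.le),
      SchwartzMap.smulLeftCLM_apply_apply hgq]
    simp only [hg_def, hq_def, Pi.mul_apply, smul_eq_mul, Complex.real_smul]
    push_cast
    ring
  -- (4) `u ∘ 𝓕` is bounded by finitely many Schwartz seminorms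
  obtain ⟨S, C, hC0, hSC⟩ : ∃ (S : Finset (ℕ × ℕ)) (C : ℝ), 0 ≤ C ∧ ∀ f : 𝓢(E, ℂ),
      ‖u (𝓕 f)‖ ≤ C * S.sup (schwartzSeminormFamily ℂ E ℂ) f := by
    let L : 𝓢(E, ℂ) →ₗ[ℂ] F :=
      { toFun := fun f => u (𝓕 f)
        map_add' := fun f f' => by rw [FourierAdd.fourier_add, map_add]
        map_smul' := fun c f => by rw [FourierSMul.fourier_smul, map_smul, RingHom.id_apply] }
    have hLc : Continuous L := (map_continuous u).comp FourierTransform.continuous_fourier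
    obtain ⟨S, C, -, hle⟩ := Seminorm.bound_of_continuous (schwartz_withSeminorms ℂ E ℂ)
      ((normSeminorm ℂ F).comp L) (continuous_norm.comp hLc)
    refine ⟨S, C, C.2, fun f => ?_⟩
    have h1 := Seminorm.le_def.1 hle f
    simpa only [Seminorm.comp_apply, coe_normSeminorm, smul_apply, NNReal.smul_def,
      smul_eq_mul, L, LinearMap.coe_mk, AddHom.coe_mk] using h1
  -- (5) every Schwartz seminorm of the remainder is `O(h²)`
  have key : ∀ m : ℕ × ℕ, ∃ K : ℝ, 0 ≤ K ∧ ∀ h : ℝ, |h| ≤ t / 2 →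
      schwartzSeminormFamily ℂ E ℂ m (Dh h) ≤ h ^ 2 * K := by
    rintro ⟨k, n⟩
    obtain ⟨l, KB, hKB0, hKB⟩ := norm_iteratedFDeriv_heatRemainder_le (E := E) ht n
    obtain ⟨KA, hKA0, hKA⟩ := pow_mul_norm_iteratedFDeriv_smul_le ψ k n l
    refine ⟨KB * KA, by positivity, fun h hh => ?_⟩
    rw [SchwartzMap.schwartzSeminormFamily_apply]
    refine SchwartzMap.seminorm_le_bound ℂ k n (Dh h) (by positivity) fun x => ?_
    rw [hDh_apply h hh]
    have := hKA (fun x : E => Literature.Analysis.UnboundedOperators.heatSymbol (t + h) x - Literature.Analysis.UnboundedOperators.heatSymbol t x +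
        h * ((2 * π) ^ 2 * ‖x‖ ^ 2 * Literature.Analysis.UnboundedOperators.heatSymbol t x)) (h ^ 2 * KB) (by positivity)
      (contDiff_heatRemainder t h)
      (fun j hj y => by rw [mul_assoc]; exact hKB h hh j hj y) x
    simpa only [mul_assoc] using this
  choose K hK0 hK using key
  -- (6) conclusion: the remainder is `O(h²) = o(h)`
  rw [hasDerivAt_iff_isLittleO_nhds_zero, Asymptotics.isLittleO_iff]
  intro c hc
  set Ktot : ℝ := C * ∑ m ∈ S, K m with hKtot_def
  have hKsum : 0 ≤ ∑ m ∈ S, K m := Finset.sum_nonneg fun m _ => hK0 m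
  have hKtot : 0 ≤ Ktot := mul_nonneg hC0 hKsum
  have hδ : 0 < min (t / 2) (c / (Ktot + 1)) := lt_min (by linarith) (by positivity)
  filter_upwards [Metric.ball_mem_nhds (0 : ℝ) hδ] with h hh
  rw [Metric.mem_ball, dist_zero_right, Real.norm_eq_abs, lt_min_iff] at hh
  rw [hrem h, Real.norm_eq_abs]
  have hsup : S.sup (schwartzSeminormFamily ℂ E ℂ) (Dh h) ≤ h ^ 2 * ∑ m ∈ S, K m :=
    Seminorm.finset_sup_apply_le (by positivity) fun m hm =>
      (hK m h hh.1.le).trans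
        (mul_le_mul_of_nonneg_left (Finset.single_le_sum (fun i _ => hK0 i) hm) (sq_nonneg h))
  calc ‖u (𝓕 (Dh h))‖ ≤ C * S.sup (schwartzSeminormFamily ℂ E ℂ) (Dh h) := hSC _
    _ ≤ C * (h ^ 2 * ∑ m ∈ S, K m) := mul_le_mul_of_nonneg_left hsup hC0
    _ = |h| * Ktot * |h| := by
        rw [hKtot_def, ← sq_abs]
        ring
    _ ≤ c * |h| := by
        have h1 : |h| * (Ktot + 1) ≤ c := by
          have := hh.2.le
          rwa [le_div_iff₀ (by positivity)] at this
        have h2 := mul_le_mul_of_nonneg_right h1 (abs_nonneg h)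
        nlinarith [abs_nonneg h, hKtot]

end TemperedDistribution
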